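import Literature.MathematicalPhysics.QuantumFieldTheory.Balaban1983to89.B9PinMembersKLevelV1

/-!
# `Balaban1983to89.B9BackgroundsKLevelV1P` — Stage-3′(Y) GEOMETRY∕INDEX layer, MODULE 2-P: the cube class of [Balaban1985BackgroundPropagators] p. 396 with
# PRINT'S SIZES («Here O(1) will mean a number ≧ 10», open-ended) and PRINT'S PER-CUBE CONSTANT («where O(1)M is a size of □»), the carriers
# `bg9KP i` ∕ `bg9YP x : B9.Backgrounds` over it, and their API (the `U = 1` facts of the N06 knit, the per-cube datum, the uniqueness of the index)

B9 = T. Bałaban, *Propagators for lattice gauge theories in a background field*, Commun. Math. Phys. **99** (1985) 389–434 [Balaban1985BackgroundPropagators];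
[4] = T. Bałaban, *Propagators for lattice gauge theories in a background field. II*, Commun. Math. Phys. **96** (1984) 223–250 [Balaban1984PropagatorsII].
Held text `paper:balaban1985-cmp99-background-propagators` (p. 396 = p0008, p. 404 = p0016, pp. 408–409 = p0020–p0021) and the page image of p. 396
(`…-p008-x2.png` of the pub-balaban page renders), read first-hand by this seat 2026-08-27; [4] pp. 224, 229 (p0002, p0007).
pub-ymgap Track A, node N06; seat `pub-ymgap-node00-def-Y` g7 (OWNER of the `OpsY` instance at the record; successor of the interim def-Y lineage that typed
MODULE 2 `B9BackgroundsKLevelV1` and MODULE 3 `B9PinMembersKLevelV1`).  APPEND-ONLY: a NEW module; MODULES 2, 3 and every consumer are untouched and CONSUMED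
BY NAME.  DEFINITIONS WITH BODIES + kernel-checked API; nothing of [B9]'s estimates is asserted; count-neutral.

WHAT IS PRINTED (p. 396, verbatim from the page image).  «At first let us introduce a class of cubes. For each cube □ of this class there exists a unique index j,
0 ≦ j ≦ k, such that □ ⊂ Bʲ(Λ_j) ∪ B^{j+1}(Λ_{j+1}), □ ∩ Bʲ(Λ_j) ≠ ∅, and □ is a union of several big blocks of the lattice T_{L^{−j}}, which implies that its
size in the lattice T_η is O(1)MLʲη. Here O(1) will mean a number ≧ 10. … for an arbitrary cube □ of the described above class, and for a configuration U there
exists a gauge transformation u on □ such that U^u = e^{iηA}. and if the index of □ is j, then |A| < O(1)Mα₀(Lʲη)⁻¹, |∇^ηA| < O(1)Mα₀(Lʲη)⁻² on □, where O(1)M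
is a size of □ in T_{L^{−j}}; (3.35)»; p. 409: «We have assumed that the number O(1) in the condition (3.35) can be taken as equal to 12, thus the cube □̃⁵ is
contained in one of the cubes for which this condition holds».  CORRECTION OF RECORD: MODULE 2's docstring (l. 17) quotes «a number ≤ 10» and its `IsCube396`
types `1 ≤ n ≤ 10` with ONE constant `c·M·α₀` for all cubes; the page prints «≧ 10» (lit-balaban-r06 g35, B9 fold owner, LOC-RELAY-2 answer of record,
pub-ymgap INBOX 2026-08-27 12:04:55Z; lit-balaban lead g26 concurring; re-checked here on the image).  MODULE 2's class is henceforth read as a Lean-side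
SMALL-CUBE VARIANT of print's class (the landed file stays byte-stable); THIS module types print's class: sizes open-ended from the threshold up, constant
proportional to the cube's own size — MODULE 2's «located reading (c)», there recorded-not-adopted, ADOPTED here.

WHY NOW (cell record: dag-n06-j g11 LOCATED-COVERAGE-1, INBOX 2026-08-27 11:26Z; dag-lead g10 DESK WORD «the class amendment is def-Y's call»).  [4]'s domain
axioms (2.1)–(2.2), typed faithfully as `B6MultiLevelTorusOperator.TDomains`, admit a component of `Ω_j` ONE big `j`-block thick, flanked by `Λ_{j−1}`; for
`L ≥ 19` dag-n06-j exhibited a bond on such a block that no cube of MODULE 2's small-cube class contains with both endpoints, so that class does not constrain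
`U` there (`B9Eq335CoverageAtLettersY.reg335Flip…`).  In PRINT's class that bond, the plaquettes through it, and p. 409's cube □̃⁵ at an outer boundary `∂Ω_j`
all lie in class cubes of index `j − 1` (levels `{j−1, j}` ✓, `□ ∩ B^{j−1}(Λ_{j−1}) ≠ ∅` ✓, `n ≥ 10` big `(j−1)`-blocks ✓ — e.g. `n = 10·L`, `12·L`), whose
(3.35)-datum has the scale `L^{j−1}η` and the constant `n·M·α₀`; away from lower-level territory they lie in index-`j` cubes of `n = 10`, `12`.  The `L²` between
that and p. 404's «ξ = L^{−j}, b ∈ Ω_j» at thin features is print's own tacit step (r06's located reading (T1), for the referees), not something a typed class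
should supply by assuming more about `U`.  (This seat's earlier proposal to WIDEN the level window to `{j−1, j, j+1}` — bus INTENT-16, LR-W1∕LR-W2 — is WITHDRAWN
unfiled: it contradicts «a unique index j» and demands scale-`j` smallness of `U` inside `Λ_{j−1}`, a hypothesis stronger than print.)

LOCATED READINGS OF THIS MODULE.
* LR-P1 (sizes and constant): a class cube of index `j` is an aligned torus cube of `n` big `j`-blocks with `c ≤ n`, `n` otherwise FREE, and its (3.35)∕(3.36)
  constant is `n·(M·α₀)`; the leaf's real parameter `c` (`B9.Backgrounds.Reg335 c α₀`, the knit's `c35`, pinned `10` at the record by `B9PinCarriersKLevelV1.carriersY_c35`)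
  IS print's «a number ≧ 10» (with `c = 12` one reads Sect. C's usage).  The window «□ ⊂ Bʲ(Λ_j) ∪ B^{j+1}(Λ_{j+1})» (every site of level `j` or `j+1`) and
  «□ ∩ Bʲ(Λ_j) ≠ ∅» are MODULE 2's clauses VERBATIM; the index range `1 ≤ j ≤ k` is MODULE 2's located reading (a) (no `Λ₀` on p21's families).
* LR-P2 (no side-versus-period clause): `IsCubeP` does not require `n·(M·Lʲ) <` period.  On a torus with fewer than `n` big `j`-blocks per direction the set
  `torusCube c₀ (n·bigSide j)` is the whole torus in that direction (`torusCube_eq_univ`), so on the SMALL tori of the typed family (`KIdx.hP5`: `P′ ≥ 5` big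
  `k`-blocks per direction) the top-index condition reads as a global one (`univ_mem_cubeClassP_top`).  Print's tori exceed every class cube it uses (p. 409 needs
  □̃⁵ ⊂ T); a genuineness clause would instead make the class EMPTY at index `k` whenever `P′ ≤ c`, leaving `U` unconstrained on `Λ_k` there.  Print does not
  speak to tori smaller than its cubes; this is the typed choice that keeps every plaquette of every typed torus inside some class cube.

WHAT IS DEFINED ∕ PROVED HERE (sorry-free).
* §1 `torusCube_eq_univ` (saturation), `IsCubeP i □ j n`, **`cubeClassP i c`** (triples `(□, j, n)`), `mem_cubeClassP_iff`, `cubeClassP_index`, `cubeClassP_threshold`,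
  `cubeClassP_size_pos`, `cubeClassP_levels`, `cubeClassP_meets`, `cubeClassP_nonempty`, ★ **`cubeClassP_index_unique`** (print's «there exists a unique index j»,
  kernel-checked: the index of a class cube is determined by the SET, whatever the thresholds), `cubeClassP_antitone` (raising the threshold shrinks the class),
  `alignedCube_mem_cubeClassP` (∀-form non-degeneracy), `univ_mem_cubeClassP_top` (LR-P2 made explicit: on a constant-top-level member whose torus has at most
  `n` big `k`-blocks per direction, `(T, k, n)` is a class triple).
* §2 the PER-CUBE-CONSTANT bodies `Reg335PC 𝔸 i 𝒬 C U := ∀ (□, j, n) ∈ 𝒬, Reg335Cube (shifts) U η □ (Lʲη) (n·C)` (r06's per-cube datum `B9Eq335RegularityClasses.Reg335Cube`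
  by name), `Reg336PC`, the fields `Reg335BodyP 𝔸 G i c α₀ U := «U is G-valued» ∧ Reg335PC 𝔸 i (cubeClassP i c) (M·α₀) U`, `Reg336BodyP`, and the carrier
  **`bg9KP 𝔸 G i : B9.Backgrounds`** (`Cfg`, `one`, `mul`, `Cplx337`, `Cplx338` = MODULE 2's bodies; `Reg335`, `Reg336` = the P-bodies).
* §3 API: `bg9KP_Cfg` (`rfl`), `bg9KP_Cfg_eq` ∕ `bg9KP_one_eq` ∕ `bg9KP_mul_eq` (definitionally MODULE 2's `bg9K` — every operator ∕ kernel typed over `(bg9K …).Cfg`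
  is typed over `(bg9KP …).Cfg`), `reg335P_iff`, `reg336P_iff`, `cplx337P_iff`, `cplx338P_iff`, `reg336P_reg335P`, `reg335P_mono_threshold` ∕ `reg336P_mono_threshold`,
  `reg335P_mono_group`, `reg335Cube_subset` ∕ `reg335Cube_mono_const` (r06's per-cube datum restricts to sub-sets and weakens in the constant), ★ `reg335P_one` ∕
  `reg336P_one` ∕ `cplx337P_one` (`U ≡ 1` is P-regular for EVERY threshold `c` and every `α₀ > 0` — the knit's `hone`; no `0 < c` needed since the constant is
  `n·M·α₀`, `n ≥ 1`), `not_reg335P_of_not_mem`, `mem_of_reg335P`, ★ **`reg335CubeP_of_reg335P`** (the datum at a class triple: scale `Lʲη`, constant `n·(M·α₀)`),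
  `reg335CubeP_of_reg335P_subset` (… on any sub-set of the cube, e.g. the four corners of a plaquette — composes with the class-independent per-cube consumers such as
  `B9Eq335PlaquetteAtLettersY.norm_holY_sub_one_le_of_reg335Cube`).
* §4 the member twin **`bg9YP 𝔸 G x`** for `x : B9PinMembersKLevelV1.MemberY …` (the P-classes for BOTH sequences `{Ω_j}`, `{Ω′_j}`, as MODULE 3's `bg9Y`):
  `bg9YP_Cfg` ∕ `_Cfg_eq` ∕ `_one_eq` ∕ `_mul_eq`, `reg335YP_iff`, `reg336YP_iff`, `cplx337YP_iff`, `reg336YP_reg335YP`, `reg335YP_mono_threshold`, `reg335YP_one` ∕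
  `reg336YP_one` ∕ `cplx337YP_one`, `bg9YP_reg335_diag`, `bg9YP_diag_eq`.
NO implication between `(bg9KP …).Reg335` and MODULE 2's `(bg9K …).Reg335` is claimed (none holds in general; the two classes share the cubes `n = c = 10` with the
same constant).  NOT HERE (other seats' lanes, said on the bus): the COVERAGE theorem «every plaquette lies in a class cube of index `lev − 1` or `lev`» (dag-n06-j);
the carrier bundle ∕ knit over `bg9YP` (`carriersYP`, this seat's next file); the record re-pin (node00-def-K0a); the certificate binders (dag-n06-d).
HONEST SCOPE: carriers and classes only; a HYPOTHESIS class re-sized to print; NO operator of [B9] defined, NO estimate asserted; N06 not discharged; counts unmoved;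
one finite lattice programme; NOT continuum ∕ OS ∕ mass gap ∕ Clay.  No `sorry`, no `axiom`, no `instance`, no `notation`.
-/

noncomputable section

namespace Literature.MathematicalPhysics.QuantumFieldTheory.Balaban1983to89.B9BackgroundsKLevelV1P

open B6MultiLevelBoxOperator (bigSide)
open B6KLevelCensusIndexV1 (KIdx kGeo)
open B6GlobalChartV1 (PV)
open LatticeNorms (scaleLen)
open B9Eq335RegularityClasses (Reg335Cube Reg336Cube scaleLen_pos)
open B9BackgroundsKLevelV1 (torusCube levV1 CfgV1 shiftsV1 Cplx337Body Cplx338Body bg9K)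
open B9PinMembersKLevelV1 (MemberY bg9Y)

variable {d ℓ : ℕ} {hd : 1 ≤ d + 1} {hL : Odd (ℓ + 1) ∧ 1 < ℓ + 1} {b₀ b₁ : ℝ}

/-! ## §1 Print's cube class (LR-P1, LR-P2) -/

/-- SATURATION: a torus cube whose side is at least the period is the whole torus (LR-P2). [cite: Balaban1985BackgroundPropagators, p.396 («a class of cubes»; bookkeeping on the finite torus)] -/
theorem torusCube_eq_univ {P : Params} (c₀ : Site P 0) {s : ℕ} (hs : P.sitesPerDir 0 ≤ s) : torusCube c₀ s = Set.univ := by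
  haveI : NeZero (P.sitesPerDir 0) := NeZero.of_pos (lt_trans zero_lt_one (P.one_lt_sitesPerDir 0))
  ext x
  simp only [torusCube, Set.mem_setOf_eq, Set.mem_univ, iff_true]
  intro μ
  exact lt_of_lt_of_le (ZMod.val_lt _) hs

/-- «□ is a union of several big blocks of the lattice T_{L^{−j}} … its size … is O(1)MLʲη»: □ is the torus cube of `n ≥ 1` big `j`-blocks per side (side
`n·(M·Lʲ)` fine units) with corner on the big-`j`-block grid; `n` is the cube's «O(1)», open-ended (LR-P1); no side-versus-period clause (LR-P2).
[cite: Balaban1985BackgroundPropagators, p.396 (the cube class)] -/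
def IsCubeP (i : KIdx d ℓ hd hL b₀ b₁) (cube : Set (Site (PV d ℓ i.m i.K hd hL) 0)) (j n : ℕ) : Prop :=
  ∃ c₀ : Site (PV d ℓ i.m i.K hd hL) 0, 1 ≤ n ∧ (∀ μ, bigSide ℓ i.Mh j ∣ (c₀ μ).val) ∧ cube = torusCube c₀ (n * bigSide ℓ i.Mh j)

/-- **PRINT'S CUBE CLASS** for the member `i` at the threshold `c` («Here O(1) will mean a number ≧ 10»; `c = 10` at the record), as a family of triples
`(□, j, n)`: index `1 ≤ j ≤ k`, size `c ≤ n`, `□` an aligned cube of `n` big `j`-blocks, «□ ⊂ Bʲ(Λ_j) ∪ B^{j+1}(Λ_{j+1})» (every site of level `j` or `j+1`),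
«□ ∩ Bʲ(Λ_j) ≠ ∅». [cite: Balaban1985BackgroundPropagators, p.396 (the cube class, «≧ 10»), p.409 («equal to 12»)] -/
def cubeClassP (i : KIdx d ℓ hd hL b₀ b₁) (c : ℝ) : Set (Set (Site (PV d ℓ i.m i.K hd hL) 0) × ℕ × ℕ) :=
  {q | 1 ≤ q.2.1 ∧ q.2.1 ≤ i.k ∧ c ≤ (q.2.2 : ℝ) ∧ IsCubeP i q.1 q.2.1 q.2.2 ∧
    (∀ x ∈ q.1, levV1 i x = q.2.1 ∨ levV1 i x = q.2.1 + 1) ∧ ∃ x ∈ q.1, levV1 i x = q.2.1}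

/-- membership in print's class, unfolded. [cite: Balaban1985BackgroundPropagators, p.396 (bookkeeping)] -/
theorem mem_cubeClassP_iff (i : KIdx d ℓ hd hL b₀ b₁) (c : ℝ) (cube : Set (Site (PV d ℓ i.m i.K hd hL) 0)) (j n : ℕ) :
    (cube, j, n) ∈ cubeClassP i c ↔
      1 ≤ j ∧ j ≤ i.k ∧ c ≤ (n : ℝ) ∧ IsCubeP i cube j n ∧ (∀ x ∈ cube, levV1 i x = j ∨ levV1 i x = j + 1) ∧ ∃ x ∈ cube, levV1 i x = j :=
  Iff.rfl

/-- the index of a class cube lies in `[1, k]`. [cite: Balaban1985BackgroundPropagators, p.396 («0 ≦ j ≦ k»; located reading (a) of MODULE 2)] -/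
theorem cubeClassP_index {i : KIdx d ℓ hd hL b₀ b₁} {c : ℝ} {q : Set (Site (PV d ℓ i.m i.K hd hL) 0) × ℕ × ℕ} (hq : q ∈ cubeClassP i c) :
    1 ≤ q.2.1 ∧ q.2.1 ≤ i.k :=
  ⟨hq.1, hq.2.1⟩

/-- the size of a class cube is at least the threshold («a number ≧ 10»). [cite: Balaban1985BackgroundPropagators, p.396 («≧ 10»)] -/
theorem cubeClassP_threshold {i : KIdx d ℓ hd hL b₀ b₁} {c : ℝ} {q : Set (Site (PV d ℓ i.m i.K hd hL) 0) × ℕ × ℕ} (hq : q ∈ cubeClassP i c) :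
    c ≤ (q.2.2 : ℝ) :=
  hq.2.2.1

/-- a class cube has at least one big block per side. [cite: Balaban1985BackgroundPropagators, p.396 («a union of several big blocks»)] -/
theorem cubeClassP_size_pos {i : KIdx d ℓ hd hL b₀ b₁} {c : ℝ} {q : Set (Site (PV d ℓ i.m i.K hd hL) 0) × ℕ × ℕ} (hq : q ∈ cubeClassP i c) :
    1 ≤ q.2.2 := by
  obtain ⟨-, hn, -, -⟩ := hq.2.2.2.1
  exact hn

/-- «□ ⊂ Bʲ(Λ_j) ∪ B^{j+1}(Λ_{j+1})»: every site of a class cube has level `j` or `j + 1`. [cite: Balaban1985BackgroundPropagators, p.396] -/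
theorem cubeClassP_levels {i : KIdx d ℓ hd hL b₀ b₁} {c : ℝ} {q : Set (Site (PV d ℓ i.m i.K hd hL) 0) × ℕ × ℕ} (hq : q ∈ cubeClassP i c)
    {x : Site (PV d ℓ i.m i.K hd hL) 0} (hx : x ∈ q.1) : levV1 i x = q.2.1 ∨ levV1 i x = q.2.1 + 1 :=
  hq.2.2.2.2.1 x hx

/-- «□ ∩ Bʲ(Λ_j) ≠ ∅». [cite: Balaban1985BackgroundPropagators, p.396] -/
theorem cubeClassP_meets {i : KIdx d ℓ hd hL b₀ b₁} {c : ℝ} {q : Set (Site (PV d ℓ i.m i.K hd hL) 0) × ℕ × ℕ} (hq : q ∈ cubeClassP i c) :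
    ∃ x ∈ q.1, levV1 i x = q.2.1 :=
  hq.2.2.2.2.2

/-- a class cube is non-empty. [cite: Balaban1985BackgroundPropagators, p.396 (bookkeeping)] -/
theorem cubeClassP_nonempty {i : KIdx d ℓ hd hL b₀ b₁} {c : ℝ} {q : Set (Site (PV d ℓ i.m i.K hd hL) 0) × ℕ × ℕ} (hq : q ∈ cubeClassP i c) :
    q.1.Nonempty := by
  obtain ⟨x, hx, -⟩ := hq.2.2.2.2.2
  exact ⟨x, hx⟩

/-- ★ «for each cube □ of this class there exists a UNIQUE index j»: the index is determined by the set (it is the least level met), across thresholds and sizes.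
[cite: Balaban1985BackgroundPropagators, p.396 («a unique index j»)] -/
theorem cubeClassP_index_unique {i : KIdx d ℓ hd hL b₀ b₁} {c c' : ℝ} {cube : Set (Site (PV d ℓ i.m i.K hd hL) 0)} {j n j' n' : ℕ}
    (h : (cube, j, n) ∈ cubeClassP i c) (h' : (cube, j', n') ∈ cubeClassP i c') : j = j' := by
  obtain ⟨x, hx, hxj⟩ := h.2.2.2.2.2
  obtain ⟨x', hx', hxj'⟩ := h'.2.2.2.2.2
  have h₁ := h'.2.2.2.2.1 x hx
  have h₂ := h.2.2.2.2.1 x' hx'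
  simp only at hxj hxj' h₁ h₂
  omega

/-- raising the threshold shrinks the class. [cite: Balaban1985BackgroundPropagators, p.396 («≧ 10»; bookkeeping)] -/
theorem cubeClassP_antitone (i : KIdx d ℓ hd hL b₀ b₁) {c c' : ℝ} (h : c ≤ c') : cubeClassP i c' ⊆ cubeClassP i c :=
  fun _ hq => ⟨hq.1, hq.2.1, le_trans h hq.2.2.1, hq.2.2.2⟩

/-- NON-DEGENERACY (∀-form): every aligned cube of `n ≥ max(1, c)` big `j`-blocks, `1 ≤ j ≤ k`, whose sites have levels `j` or `j+1` and which meets level `j`,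
is a class triple. [cite: Balaban1985BackgroundPropagators, p.396 (the class)] -/
theorem alignedCube_mem_cubeClassP (i : KIdx d ℓ hd hL b₀ b₁) {c : ℝ} {j n : ℕ} (hj1 : 1 ≤ j) (hjk : j ≤ i.k) (hn : 1 ≤ n) (hcn : c ≤ (n : ℝ))
    (c₀ : Site (PV d ℓ i.m i.K hd hL) 0) (hc₀ : ∀ μ, bigSide ℓ i.Mh j ∣ (c₀ μ).val)
    (hlev : ∀ x ∈ torusCube c₀ (n * bigSide ℓ i.Mh j), levV1 i x = j ∨ levV1 i x = j + 1)
    (hmeet : ∃ x ∈ torusCube c₀ (n * bigSide ℓ i.Mh j), levV1 i x = j) :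
    (torusCube c₀ (n * bigSide ℓ i.Mh j), j, n) ∈ cubeClassP i c :=
  ⟨hj1, hjk, hcn, ⟨c₀, hn, hc₀, rfl⟩, hlev, hmeet⟩

/-- LR-P2 made explicit: on a member all of whose sites have the top level `k`, and whose torus has at most `n` big `k`-blocks per direction (`n ≥ max(1, c)`),
the WHOLE TORUS with index `k` and size `n` is a class triple. [cite: Balaban1985BackgroundPropagators, p.396 (the class; typed small-torus reading LR-P2); Balaban1984PropagatorsII, (2.1) p.224 («some domains Ω_j are equal to T_η»)] -/
theorem univ_mem_cubeClassP_top (i : KIdx d ℓ hd hL b₀ b₁) {c : ℝ} {n : ℕ} (hn : 1 ≤ n) (hcn : c ≤ (n : ℝ))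
    (hs : (PV d ℓ i.m i.K hd hL).sitesPerDir 0 ≤ n * bigSide ℓ i.Mh i.k) (htop : ∀ x : Site (PV d ℓ i.m i.K hd hL) 0, levV1 i x = i.k) :
    (Set.univ, i.k, n) ∈ cubeClassP i c := by
  have hcube : torusCube (0 : Site (PV d ℓ i.m i.K hd hL) 0) (n * bigSide ℓ i.Mh i.k) = Set.univ := torusCube_eq_univ _ hs
  refine ⟨le_trans one_le_two i.hk2, le_rfl, hcn, ⟨0, hn, fun μ => ?_, hcube.symm⟩, fun x _ => Or.inl (htop x), ⟨0, Set.mem_univ _, htop 0⟩⟩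
  rw [show (0 : Site (PV d ℓ i.m i.K hd hL) 0) μ = 0 from rfl, ZMod.val_zero]
  exact dvd_zero _

/-! ## §2 The per-cube-constant bodies and the background carrier of a member -/

section Carrier

variable (𝔸 : Type) [NormedRing 𝔸] [NormedAlgebra ℂ 𝔸] [CompleteSpace 𝔸] (G : Subgroup 𝔸ˣ)

/-- (3.35) over an indexed-and-sized family `𝒬` of cubes with the PER-CUBE constant: on `(□, j, n) ∈ 𝒬` the datum `Reg335Cube` at the scale `Lʲη` with the
constant `n·C` («|A| < O(1)Mα₀(Lʲη)⁻¹ … where O(1)M is a size of □»; `C = M·α₀`). [cite: Balaban1985BackgroundPropagators, (3.35) p.396] -/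
def Reg335PC (i : KIdx d ℓ hd hL b₀ b₁) (𝒬 : Set (Set (Site (PV d ℓ i.m i.K hd hL) 0) × ℕ × ℕ)) (C : ℝ) (U : CfgV1 (PV d ℓ i.m i.K hd hL) 𝔸) : Prop :=
  ∀ q ∈ 𝒬, Reg335Cube (shiftsV1 _) U (kGeo i).eta q.1 (scaleLen (kGeo i).L (kGeo i).eta q.2.1) ((q.2.2 : ℝ) * C)

/-- (3.35)–(3.36) over an indexed-and-sized family with the per-cube constant. [cite: Balaban1985BackgroundPropagators, (3.35)–(3.36) p.396] -/
def Reg336PC (i : KIdx d ℓ hd hL b₀ b₁) (𝒬 : Set (Set (Site (PV d ℓ i.m i.K hd hL) 0) × ℕ × ℕ)) (C : ℝ) (U : CfgV1 (PV d ℓ i.m i.K hd hL) 𝔸) : Prop :=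
  ∀ q ∈ 𝒬, Reg336Cube (shiftsV1 _) U (kGeo i).eta q.1 (scaleLen (kGeo i).L (kGeo i).eta q.2.1) ((q.2.2 : ℝ) * C)

/-- the body of the field (3.35): «U is G-valued» ∧ (3.35) over print's class at the threshold `c` with the per-cube constant `n·(M·α₀)`.
[cite: Balaban1985BackgroundPropagators, (3.35) p.396] -/
def Reg335BodyP (i : KIdx d ℓ hd hL b₀ b₁) (c α₀ : ℝ) (U : CfgV1 (PV d ℓ i.m i.K hd hL) 𝔸) : Prop :=
  (∀ μ x, U μ x ∈ G) ∧ Reg335PC 𝔸 i (cubeClassP i c) ((kGeo i).M * α₀) U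

/-- the body of the field (3.36). [cite: Balaban1985BackgroundPropagators, (3.35)–(3.36) p.396] -/
def Reg336BodyP (i : KIdx d ℓ hd hL b₀ b₁) (c α₀ : ℝ) (U : CfgV1 (PV d ℓ i.m i.K hd hL) 𝔸) : Prop :=
  (∀ μ x, U μ x ∈ G) ∧ Reg336PC 𝔸 i (cubeClassP i c) ((kGeo i).M * α₀) U

/-- **THE BACKGROUND CARRIER OF A k-LEVEL MEMBER OVER PRINT'S CLASS**: MODULE 2's configurations, trivial configuration, product and complex classes
(3.37)–(3.38), with the regularity classes (3.35)–(3.36) over print's cube class and per-cube constant. [cite: Balaban1985BackgroundPropagators, (3.35)–(3.38) p.396] -/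
def bg9KP (i : KIdx d ℓ hd hL b₀ b₁) : B9.Backgrounds where
  Cfg := CfgV1 (PV d ℓ i.m i.K hd hL) 𝔸
  one := fun _ _ => 1
  mul := fun U' U μ x => U' μ x * U μ x
  Reg335 := Reg335BodyP 𝔸 G i
  Reg336 := Reg336BodyP 𝔸 G i
  Cplx337 := Cplx337Body 𝔸 i
  Cplx338 := Cplx338Body 𝔸 i

/-! ## §3 API: unfoldings, monotonicity, the per-cube datum, the `U = 1` facts -/

variable {𝔸 G}

/-- the configurations of the carrier are the torus gauge fields. [cite: Balaban1985BackgroundPropagators, Sect. A p.390 (bookkeeping)] -/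
theorem bg9KP_Cfg (i : KIdx d ℓ hd hL b₀ b₁) : (bg9KP 𝔸 G i).Cfg = CfgV1 (PV d ℓ i.m i.K hd hL) 𝔸 := rfl

/-- … DEFINITIONALLY those of MODULE 2's carrier `bg9K`. [cite: Balaban1985BackgroundPropagators, Sect. A p.390 (bookkeeping)] -/
theorem bg9KP_Cfg_eq (i : KIdx d ℓ hd hL b₀ b₁) : (bg9KP 𝔸 G i).Cfg = (bg9K 𝔸 G i).Cfg := rfl

/-- the trivial configuration is MODULE 2's. [cite: Balaban1985BackgroundPropagators, Cor. 3.5 p.407 («U = 1»; bookkeeping)] -/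
theorem bg9KP_one_eq (i : KIdx d ℓ hd hL b₀ b₁) : (bg9KP 𝔸 G i).one = (bg9K 𝔸 G i).one := rfl

/-- the product is MODULE 2's. [cite: Balaban1985BackgroundPropagators, p.396 («they have the form U′U»; bookkeeping)] -/
theorem bg9KP_mul_eq (i : KIdx d ℓ hd hL b₀ b₁) : (bg9KP 𝔸 G i).mul = (bg9K 𝔸 G i).mul := rfl

/-- the field (3.35) unfolded. [cite: Balaban1985BackgroundPropagators, (3.35) p.396 (bookkeeping)] -/
theorem reg335P_iff (i : KIdx d ℓ hd hL b₀ b₁) (c α₀ : ℝ) (U : CfgV1 (PV d ℓ i.m i.K hd hL) 𝔸) :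
    (bg9KP 𝔸 G i).Reg335 c α₀ U ↔
      (∀ μ x, U μ x ∈ G) ∧
        ∀ q ∈ cubeClassP i c, Reg335Cube (shiftsV1 _) U (kGeo i).eta q.1 (scaleLen (kGeo i).L (kGeo i).eta q.2.1) ((q.2.2 : ℝ) * ((kGeo i).M * α₀)) :=
  Iff.rfl

/-- the field (3.36) unfolded. [cite: Balaban1985BackgroundPropagators, (3.36) p.396 (bookkeeping)] -/
theorem reg336P_iff (i : KIdx d ℓ hd hL b₀ b₁) (c α₀ : ℝ) (U : CfgV1 (PV d ℓ i.m i.K hd hL) 𝔸) :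
    (bg9KP 𝔸 G i).Reg336 c α₀ U ↔
      (∀ μ x, U μ x ∈ G) ∧
        ∀ q ∈ cubeClassP i c, Reg336Cube (shiftsV1 _) U (kGeo i).eta q.1 (scaleLen (kGeo i).L (kGeo i).eta q.2.1) ((q.2.2 : ℝ) * ((kGeo i).M * α₀)) :=
  Iff.rfl

/-- the field (3.37) IS MODULE 2's. [cite: Balaban1985BackgroundPropagators, (3.37) p.396 (bookkeeping)] -/
theorem cplx337P_iff (i : KIdx d ℓ hd hL b₀ b₁) (α₁ : ℝ) (U U' : CfgV1 (PV d ℓ i.m i.K hd hL) 𝔸) :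
    (bg9KP 𝔸 G i).Cplx337 α₁ U U' ↔ (bg9K 𝔸 G i).Cplx337 α₁ U U' :=
  Iff.rfl

/-- the field (3.38) IS MODULE 2's. [cite: Balaban1985BackgroundPropagators, (3.38) p.396 (bookkeeping)] -/
theorem cplx338P_iff (i : KIdx d ℓ hd hL b₀ b₁) (α₁ : ℝ) (U U' : CfgV1 (PV d ℓ i.m i.K hd hL) 𝔸) :
    (bg9KP 𝔸 G i).Cplx338 α₁ U U' ↔ (bg9K 𝔸 G i).Cplx338 α₁ U U' :=
  Iff.rfl

/-- «later on we will have to assume (3.36) also»: (3.35)–(3.36) ⇒ (3.35). [cite: Balaban1985BackgroundPropagators, p.396 (after (3.36))] -/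
theorem reg336P_reg335P (i : KIdx d ℓ hd hL b₀ b₁) {c α₀ : ℝ} {U : CfgV1 (PV d ℓ i.m i.K hd hL) 𝔸}
    (h : (bg9KP 𝔸 G i).Reg336 c α₀ U) : (bg9KP 𝔸 G i).Reg335 c α₀ U :=
  ⟨h.1, fun q hq => (h.2 q hq).reg335Cube _ _⟩

/-- raising the threshold weakens the condition (fewer cubes). [cite: Balaban1985BackgroundPropagators, p.396 («≧ 10»), p.409 («equal to 12»)] -/
theorem reg335P_mono_threshold (i : KIdx d ℓ hd hL b₀ b₁) {c c' α₀ : ℝ} (hcc : c ≤ c') {U : CfgV1 (PV d ℓ i.m i.K hd hL) 𝔸}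
    (h : (bg9KP 𝔸 G i).Reg335 c α₀ U) : (bg9KP 𝔸 G i).Reg335 c' α₀ U :=
  ⟨h.1, fun q hq => h.2 q (cubeClassP_antitone i hcc hq)⟩

/-- the same for (3.36). [cite: Balaban1985BackgroundPropagators, p.396 («≧ 10»), p.409 («equal to 12»)] -/
theorem reg336P_mono_threshold (i : KIdx d ℓ hd hL b₀ b₁) {c c' α₀ : ℝ} (hcc : c ≤ c') {U : CfgV1 (PV d ℓ i.m i.K hd hL) 𝔸}
    (h : (bg9KP 𝔸 G i).Reg336 c α₀ U) : (bg9KP 𝔸 G i).Reg336 c' α₀ U :=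
  ⟨h.1, fun q hq => h.2 q (cubeClassP_antitone i hcc hq)⟩

/-- monotonicity in the gauge group. [cite: Balaban1985BackgroundPropagators, p.396 («U has values in G»; bookkeeping)] -/
theorem reg335P_mono_group {G G' : Subgroup 𝔸ˣ} (hGG : G ≤ G') (i : KIdx d ℓ hd hL b₀ b₁) {c α₀ : ℝ} {U : CfgV1 (PV d ℓ i.m i.K hd hL) 𝔸}
    (h : (bg9KP 𝔸 G i).Reg335 c α₀ U) : (bg9KP 𝔸 G' i).Reg335 c α₀ U :=
  ⟨fun μ x => hGG (h.1 μ x), h.2⟩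

/-- r06's per-cube datum RESTRICTS to sub-sets of the cube (all its clauses are pointwise on the cube). [cite: Balaban1985BackgroundPropagators, (3.35) p.396 («on □»)] -/
theorem reg335Cube_subset {i : KIdx d ℓ hd hL b₀ b₁} {U : CfgV1 (PV d ℓ i.m i.K hd hL) 𝔸} {η ξ C : ℝ}
    {cube cube' : Set (Site (PV d ℓ i.m i.K hd hL) 0)} (hsub : cube' ⊆ cube) (h : Reg335Cube (shiftsV1 _) U η cube ξ C) :
    Reg335Cube (shiftsV1 (PV d ℓ i.m i.K hd hL)) U η cube' ξ C := by
  obtain ⟨u, A, hu, hg, hA, hD⟩ := h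
  exact ⟨u, A, fun z hz => hu z (hsub hz), fun κ z hz => hg κ z (hsub hz), fun κ z hz => hA κ z (hsub hz),
    fun κ ν z hz => hD κ ν z (hsub hz)⟩

/-- r06's per-cube datum WEAKENS in the constant. [cite: Balaban1985BackgroundPropagators, (3.35) p.396 (strict bounds; bookkeeping)] -/
theorem reg335Cube_mono_const {i : KIdx d ℓ hd hL b₀ b₁} {U : CfgV1 (PV d ℓ i.m i.K hd hL) 𝔸} {η ξ C C' : ℝ} (hξ : 0 ≤ ξ) (hC : C ≤ C')
    {cube : Set (Site (PV d ℓ i.m i.K hd hL) 0)} (h : Reg335Cube (shiftsV1 _) U η cube ξ C) :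
    Reg335Cube (shiftsV1 (PV d ℓ i.m i.K hd hL)) U η cube ξ C' := by
  obtain ⟨u, A, hu, hg, hA, hD⟩ := h
  refine ⟨u, A, hu, hg, fun κ z hz => lt_of_lt_of_le (hA κ z hz) ?_, fun κ ν z hz => lt_of_lt_of_le (hD κ ν z hz) ?_⟩
  · exact mul_le_mul_of_nonneg_right hC (inv_nonneg.mpr hξ)
  · exact mul_le_mul_of_nonneg_right hC (inv_nonneg.mpr (sq_nonneg ξ))

/-- **`U ≡ 1` IS IN THE CLASS (3.35)–(3.36)** for every threshold `c` and every `α₀ > 0` (`u = 1`, `A = 0` on every cube: MODULE 2's `reg336Cube_one`; the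
constant `n·M·α₀` is positive since `n ≥ 1`). [cite: Balaban1985BackgroundPropagators, Cor. 3.5 p.407 («U = 1»)] -/
theorem reg336P_one [NormOneClass 𝔸] (i : KIdx d ℓ hd hL b₀ b₁) (c : ℝ) {α₀ : ℝ} (hα : 0 < α₀) :
    (bg9KP 𝔸 G i).Reg336 c α₀ (bg9KP 𝔸 G i).one := by
  obtain ⟨hη, hL1, hM⟩ := B9BackgroundsKLevelV1.eta_pos_L_one_le_M_pos i
  refine ⟨fun _ _ => G.one_mem, fun q hq => ?_⟩
  have hn : (1 : ℝ) ≤ (q.2.2 : ℝ) := by exact_mod_cast cubeClassP_size_pos hq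
  exact B9BackgroundsKLevelV1.reg336Cube_one (shiftsV1 _) q.1 (scaleLen_pos hL1 hη q.2.1)
    (mul_pos (lt_of_lt_of_le zero_lt_one hn) (mul_pos hM hα))

/-- **`U ≡ 1` IS IN THE CLASS (3.35)** — the knit's `hone`. [cite: Balaban1985BackgroundPropagators, Cor. 3.5 p.407 («U = 1»)] -/
theorem reg335P_one [NormOneClass 𝔸] (i : KIdx d ℓ hd hL b₀ b₁) (c : ℝ) {α₀ : ℝ} (hα : 0 < α₀) :
    (bg9KP 𝔸 G i).Reg335 c α₀ (bg9KP 𝔸 G i).one :=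
  reg336P_reg335P i (reg336P_one i c hα)

/-- the trivial perturbation is in the class (3.37) over any background (MODULE 2's `cplx337_one`). [cite: Balaban1985BackgroundPropagators, (3.37) p.396] -/
theorem cplx337P_one (i : KIdx d ℓ hd hL b₀ b₁) {α₁ : ℝ} (hα : 0 < α₁) (U : CfgV1 (PV d ℓ i.m i.K hd hL) 𝔸) :
    (bg9KP 𝔸 G i).Cplx337 α₁ U (bg9KP 𝔸 G i).one :=
  B9BackgroundsKLevelV1.cplx337_one (G := G) i hα U

/-- NON-DEGENERACY (∀-form): a configuration with a value outside `G` is not in the class. [cite: Balaban1985BackgroundPropagators, p.396 («U has values in G»)] -/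
theorem not_reg335P_of_not_mem (i : KIdx d ℓ hd hL b₀ b₁) {c α₀ : ℝ} {U : CfgV1 (PV d ℓ i.m i.K hd hL) 𝔸} {μ : Fin (d + 1)}
    {x : Site (PV d ℓ i.m i.K hd hL) 0} (hx : U μ x ∉ G) : ¬ (bg9KP 𝔸 G i).Reg335 c α₀ U :=
  fun h => hx (h.1 μ x)

/-- a regular configuration is `G`-valued. [cite: Balaban1985BackgroundPropagators, p.396 («U has values in G»)] -/
theorem mem_of_reg335P (i : KIdx d ℓ hd hL b₀ b₁) {c α₀ : ℝ} {U : CfgV1 (PV d ℓ i.m i.K hd hL) 𝔸}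
    (h : (bg9KP 𝔸 G i).Reg335 c α₀ U) (μ : Fin (d + 1)) (x : Site (PV d ℓ i.m i.K hd hL) 0) : U μ x ∈ G :=
  h.1 μ x

/-- ★ **THE PER-CUBE DATUM OF A REGULAR CONFIGURATION AT A CLASS TRIPLE `(□, j, n)`**: r06's `Reg335Cube` on `□` at the scale `Lʲη` with the constant
`n·(M·α₀)` — print's «|A| < O(1)Mα₀(Lʲη)⁻¹, |∇^ηA| < O(1)Mα₀(Lʲη)⁻² on □, where O(1)M is a size of □». [cite: Balaban1985BackgroundPropagators, (3.35) p.396] -/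
theorem reg335CubeP_of_reg335P (i : KIdx d ℓ hd hL b₀ b₁) {c α₀ : ℝ} {U : CfgV1 (PV d ℓ i.m i.K hd hL) 𝔸}
    (h : (bg9KP 𝔸 G i).Reg335 c α₀ U) {q : Set (Site (PV d ℓ i.m i.K hd hL) 0) × ℕ × ℕ} (hq : q ∈ cubeClassP i c) :
    Reg335Cube (shiftsV1 (PV d ℓ i.m i.K hd hL)) U (kGeo i).eta q.1 (scaleLen (kGeo i).L (kGeo i).eta q.2.1) ((q.2.2 : ℝ) * ((kGeo i).M * α₀)) :=
  h.2 q hq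

/-- … and on any sub-set of the cube (e.g. the four corners of a plaquette inside it). [cite: Balaban1985BackgroundPropagators, (3.35) p.396 («on □»)] -/
theorem reg335CubeP_of_reg335P_subset (i : KIdx d ℓ hd hL b₀ b₁) {c α₀ : ℝ} {U : CfgV1 (PV d ℓ i.m i.K hd hL) 𝔸}
    (h : (bg9KP 𝔸 G i).Reg335 c α₀ U) {q : Set (Site (PV d ℓ i.m i.K hd hL) 0) × ℕ × ℕ} (hq : q ∈ cubeClassP i c)
    {S : Set (Site (PV d ℓ i.m i.K hd hL) 0)} (hS : S ⊆ q.1) :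
    Reg335Cube (shiftsV1 (PV d ℓ i.m i.K hd hL)) U (kGeo i).eta S (scaleLen (kGeo i).L (kGeo i).eta q.2.1) ((q.2.2 : ℝ) * ((kGeo i).M * α₀)) :=
  reg335Cube_subset hS (h.2 q hq)

end Carrier

/-! ## §4 The backgrounds of a member over print's class (both sequences), twin of MODULE 3's `bg9Y` -/

section Member

variable {Mstar : ℕ}
variable (𝔸 : Type) [NormedRing 𝔸] [NormedAlgebra ℂ 𝔸] [CompleteSpace 𝔸] (G : Subgroup 𝔸ˣ)

/-- **the backgrounds of a member over print's class**: the carrier at the member's index with the classes (3.35)∕(3.36) taken for BOTH sequences `{Ω_j}`,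
`{Ω′_j}` (MODULE 3's typing choice Q-Y2, verbatim with `bg9KP` for `bg9K`). [cite: Balaban1985BackgroundPropagators, (3.35)–(3.38) p.396, Thm 3.14 pp.426–427] -/
def bg9YP (x : MemberY d ℓ hd hL b₀ b₁ Mstar) : B9.Backgrounds :=
  { bg9KP 𝔸 G x.toKIdx with
    Reg335 := fun c α₀ U => (bg9KP 𝔸 G x.toKIdx).Reg335 c α₀ U ∧ (bg9KP 𝔸 G x.snd).Reg335 c α₀ U
    Reg336 := fun c α₀ U => (bg9KP 𝔸 G x.toKIdx).Reg336 c α₀ U ∧ (bg9KP 𝔸 G x.snd).Reg336 c α₀ U }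

variable {𝔸 G}

/-- configurations of a member are the torus gauge fields. [cite: Balaban1985BackgroundPropagators, Sect. A p.390 (bookkeeping)] -/
theorem bg9YP_Cfg (x : MemberY d ℓ hd hL b₀ b₁ Mstar) : (bg9YP 𝔸 G x).Cfg = CfgV1 (PV d ℓ x.m x.K hd hL) 𝔸 := rfl

/-- … DEFINITIONALLY those of MODULE 3's `bg9Y` (the operator layer `OperatorLayerY` ∕ `OpsY` is typed over this `Cfg`). [cite: Balaban1985BackgroundPropagators, Sect. A p.390 (bookkeeping)] -/
theorem bg9YP_Cfg_eq (x : MemberY d ℓ hd hL b₀ b₁ Mstar) : (bg9YP 𝔸 G x).Cfg = (bg9Y 𝔸 G x).Cfg := rfl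

/-- the trivial configuration of a member is MODULE 3's. [cite: Balaban1985BackgroundPropagators, Cor. 3.5 p.407 («U = 1»; bookkeeping)] -/
theorem bg9YP_one_eq (x : MemberY d ℓ hd hL b₀ b₁ Mstar) : (bg9YP 𝔸 G x).one = (bg9Y 𝔸 G x).one := rfl

/-- the product of a member is MODULE 3's. [cite: Balaban1985BackgroundPropagators, p.396 («U′U»; bookkeeping)] -/
theorem bg9YP_mul_eq (x : MemberY d ℓ hd hL b₀ b₁ Mstar) : (bg9YP 𝔸 G x).mul = (bg9Y 𝔸 G x).mul := rfl

/-- the field (3.35) of a member, unfolded: regular for `{Ω_j}` AND for `{Ω′_j}`. [cite: Balaban1985BackgroundPropagators, (3.35) p.396, Thm 3.14 pp.426–427] -/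
theorem reg335YP_iff (x : MemberY d ℓ hd hL b₀ b₁ Mstar) (c α₀ : ℝ) (U : CfgV1 (PV d ℓ x.m x.K hd hL) 𝔸) :
    (bg9YP 𝔸 G x).Reg335 c α₀ U ↔ (bg9KP 𝔸 G x.toKIdx).Reg335 c α₀ U ∧ (bg9KP 𝔸 G x.snd).Reg335 c α₀ U :=
  Iff.rfl

/-- the field (3.36) of a member, unfolded. [cite: Balaban1985BackgroundPropagators, (3.36) p.396] -/
theorem reg336YP_iff (x : MemberY d ℓ hd hL b₀ b₁ Mstar) (c α₀ : ℝ) (U : CfgV1 (PV d ℓ x.m x.K hd hL) 𝔸) :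
    (bg9YP 𝔸 G x).Reg336 c α₀ U ↔ (bg9KP 𝔸 G x.toKIdx).Reg336 c α₀ U ∧ (bg9KP 𝔸 G x.snd).Reg336 c α₀ U :=
  Iff.rfl

/-- the field (3.37) of a member IS MODULE 3's (relative to `{Ω_j}`; class-independent). [cite: Balaban1985BackgroundPropagators, (3.37) p.396] -/
theorem cplx337YP_iff (x : MemberY d ℓ hd hL b₀ b₁ Mstar) (α₁ : ℝ) (U U' : CfgV1 (PV d ℓ x.m x.K hd hL) 𝔸) :
    (bg9YP 𝔸 G x).Cplx337 α₁ U U' ↔ (bg9Y 𝔸 G x).Cplx337 α₁ U U' :=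
  Iff.rfl

/-- (3.36) implies (3.35) at a member. [cite: Balaban1985BackgroundPropagators, p.396 (after (3.36))] -/
theorem reg336YP_reg335YP (x : MemberY d ℓ hd hL b₀ b₁ Mstar) {c α₀ : ℝ} {U : CfgV1 (PV d ℓ x.m x.K hd hL) 𝔸}
    (h : (bg9YP 𝔸 G x).Reg336 c α₀ U) : (bg9YP 𝔸 G x).Reg335 c α₀ U :=
  ⟨reg336P_reg335P _ h.1, reg336P_reg335P _ h.2⟩

/-- raising the threshold weakens the condition at a member. [cite: Balaban1985BackgroundPropagators, p.396 («≧ 10»), p.409 («equal to 12»)] -/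
theorem reg335YP_mono_threshold (x : MemberY d ℓ hd hL b₀ b₁ Mstar) {c c' α₀ : ℝ} (hcc : c ≤ c') {U : CfgV1 (PV d ℓ x.m x.K hd hL) 𝔸}
    (h : (bg9YP 𝔸 G x).Reg335 c α₀ U) : (bg9YP 𝔸 G x).Reg335 c' α₀ U :=
  ⟨reg335P_mono_threshold _ hcc h.1, reg335P_mono_threshold _ hcc h.2⟩

/-- **`U ≡ 1` is in the class (3.35)–(3.36) of every member** (both sequences), every threshold, every `α₀ > 0`. [cite: Balaban1985BackgroundPropagators, Cor. 3.5 p.407 («U = 1»)] -/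
theorem reg336YP_one [NormOneClass 𝔸] (x : MemberY d ℓ hd hL b₀ b₁ Mstar) (c : ℝ) {α₀ : ℝ} (hα : 0 < α₀) :
    (bg9YP 𝔸 G x).Reg336 c α₀ (bg9YP 𝔸 G x).one :=
  ⟨reg336P_one _ c hα, reg336P_one _ c hα⟩

/-- **`U ≡ 1` is in the class (3.35) of every member** — the knit's `hone`. [cite: Balaban1985BackgroundPropagators, Cor. 3.5 p.407 («U = 1»)] -/
theorem reg335YP_one [NormOneClass 𝔸] (x : MemberY d ℓ hd hL b₀ b₁ Mstar) (c : ℝ) {α₀ : ℝ} (hα : 0 < α₀) :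
    (bg9YP 𝔸 G x).Reg335 c α₀ (bg9YP 𝔸 G x).one :=
  reg336YP_reg335YP x (reg336YP_one x c hα)

/-- the trivial perturbation is in the class (3.37) of every member. [cite: Balaban1985BackgroundPropagators, (3.37) p.396] -/
theorem cplx337YP_one (x : MemberY d ℓ hd hL b₀ b₁ Mstar) {α₁ : ℝ} (hα : 0 < α₁) (U : CfgV1 (PV d ℓ x.m x.K hd hL) 𝔸) :
    (bg9YP 𝔸 G x).Cplx337 α₁ U (bg9YP 𝔸 G x).one :=
  B9BackgroundsKLevelV1.cplx337_one (G := G) _ hα U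

/-- at a DIAGONAL member the field (3.35) is the one-sequence condition. [cite: Balaban1985BackgroundPropagators, (3.35) p.396 (bookkeeping: the one-sequence statements live at the diagonal)] -/
theorem bg9YP_reg335_diag (i : KIdx d ℓ hd hL b₀ b₁) (hcf : i.cf = (((ℓ + 1 : ℕ) : ℝ)) ^ i.k) (hM : Mstar ≤ (ℓ + 1) * i.Mh)
    (c α₀ : ℝ) (U : CfgV1 (PV d ℓ i.m i.K hd hL) 𝔸) :
    (bg9YP 𝔸 G (MemberY.diag i hcf hM : MemberY d ℓ hd hL b₀ b₁ Mstar)).Reg335 c α₀ U ↔ (bg9KP 𝔸 G i).Reg335 c α₀ U :=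
  and_self_iff

/-- at a DIAGONAL member the backgrounds ARE the one-sequence carrier. [cite: Balaban1985BackgroundPropagators, (3.35)–(3.38) p.396 (bookkeeping: the one-sequence carriers live at the diagonal)] -/
theorem bg9YP_diag_eq (i : KIdx d ℓ hd hL b₀ b₁) (hcf : i.cf = (((ℓ + 1 : ℕ) : ℝ)) ^ i.k) (hM : Mstar ≤ (ℓ + 1) * i.Mh) :
    bg9YP 𝔸 G (MemberY.diag i hcf hM : MemberY d ℓ hd hL b₀ b₁ Mstar) = bg9KP 𝔸 G i := by
  simp only [bg9YP, MemberY.toKIdx_diag, MemberY.snd_diag, and_self]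

end Member

end Literature.MathematicalPhysics.QuantumFieldTheory.Balaban1983to89.B9BackgroundsKLevelV1P

end
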